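import Summits.QuantumFields.BalabanUV.Beta.FP.ConstrainedBiLaplacianSbTwoLevelRate
import Summits.QuantumFields.BalabanUV.Beta.FP.ConstrainedBiLaplacianResponseTowerLimit
import Summits.QuantumFields.BalabanUV.Beta.FP.ConstrainedBiLaplacianSbJunction

/-!
# `BalabanUV.Beta.FP.ConstrainedBiLaplacianSbTowerLimit` — road «FP», brick (g3) «(CONV-C)-Sb», THE TWO-LEG ONE-STEP LAW, FILE T (THE TOWER LIMIT):
# the cell-pair sums of an2's `Sb` with BOTH legs integrated over fixed scale-`n₀` cells, normalised by the cell-pair count and by `N⁴`,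
# CONVERGE through all refinements `N = n₀k`, `k → ∞`, with rate `1∕k`, every refinement tower giving the same NAMED limit, and zero block sum in the limit

NOT IN PRINT; OUR PROOF ATTEMPT (binder row G-an2-4 ∕ (CONV-C), prover part P3 = fibre∕strip «Woodbury» lineage, gen 29; CRUX TEAM (2), 2026-08-21).
HONEST DEPENDENCY (cell records, verbatim): «continuum YM on T⁴ ⇐ BetaPertH ∧ nine spine estimates (0/9 proved); BetaPertH ⇐ (D1) ∧ (D4) ∧ CAP+tail;
G-an2-4 gates asym, D1 and NE2/3/4.»  HONEST FRAMING (cell contract, verbatim): «discharging `BetaPertH` makes Bałaban's UV stability UNCONDITIONAL — a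
real constructive-QFT result; it is NOT the continuum limit and NOT the Clay problem.»  ABSOLUTE RULE (cell charter, verbatim): «No internally-minted
statement may enter as a cited fact. Every hypothesis is either kernel-proved in this package or a verbatim quotation of a PUBLISHED theorem with page
reference. The manuscript(s) under audit are NOT citable for their own disputed steps — they are the thing under adjudication; programme-internal
(2001/route/tribunal) claims are never citable.»  THIS MODULE is [folklore] bookkeeping over FILE R of this programme (`two_leg_cell_kernel_rate`),
gen 28's FILES 1∕5b∕6e (`latticeKernel_avgM`; `Sb_eq_re_KS`, `KS`, `sum_finePt_KS`; the abstract `towerLim` lemmas `abs_sub_towerLim_le`∕`tendsto_towerLim`∕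
`tendsto_pow_towerLim`, the cell tests `cellNat`∕`cellNat_Tsub`) and gen 23's `Tsub_bijective`; it cites nothing as a hypothesis, has THREE bookkeeping
`def`s (`ScellT`, `SbCell`, `SbCellLim`), no `def … : Prop`, no `sorry`.

## What is proved (census V69 CLOSED by this file; d1-p3 memo §8 «convergence row for dec Sb AND dec Wb»: `Wb` = gen 28's p290645∕p291110, `Sb` = this)

With `ScellT n₀ τ₀ σ₀ x N := (N∕n₀)^{−(d+1)}·Σ_{T,T′ : cellNat T = τ₀, cellNat T′ = σ₀} latticeKernel (M N 2 T T′) x` (two fine legs integrated over the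
scale-`n₀` cells `τ₀`, `σ₀` of the blocks at separation `x`, normalised by the number `(N∕n₀)^{d+1}` of cell PAIRS per unit of fine volume, i.e. the
Riemann-sum normalisation of a double cell integral): **`ScellT_eq`** (the cell fibre is the `Tsub`-image), **`ScellT_step`**
`‖ScellT (n₀kL) − ScellT (n₀k)‖ ≤ CR (d+1) L n₀∕(n₀k)²·e^{−kappaB (d+1) 2·|x|_∞}` (FILE R), and for an2's kernel through `Sb_eq_re_KS`:
**`SbCell_eq_re`** `SbCell n₀ τ₀ σ₀ X Y N = Re (ScellT n₀ τ₀ σ₀ (X − Y) N)` where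
`SbCell … N := (N∕n₀)^{−(d+1)}·N^{−4}·Σ_{T,T′ in the cells} Sb_N (finePt N X T) (finePt N Y T′)`; hence **`abs_SbCell_sub_SbCellLim_le`**
(`≤ 2·CR (d+1) 2 n₀∕n₀²∕k·e^{−κ|X−Y|}`, every `k ≥ 1`), **`tendsto_SbCell`**, **`tendsto_SbCell_pow`** (every refinement tower `n₀L^j`, `L ≥ 2`, the same
limit `SbCellLim`), and **`sum_SbCellLim`** (`Σ_{τ₀} SbCellLim n₀ τ₀ σ₀ X Y = 0`: the zero block sum of the constrained inverse survives the limit).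
HONEST: `SbCellLim` is a NAMED limit on the fixed finite cell carrier — not identified with a continuum object.

0∕4 row-D1 binders touched.  NOT (CONV-C), NEVER «G-an2-4 closed», NOT the ghost step law, NOT SDF, NOT D1, NOT BetaPertH, NOT continuum, NOT Clay.
Provenance: prover-b2b-balaban-gan24-p3-g29-0 (unit `b2b-balaban-gan24-p3`, gen 29), 2026-08-21; no existing file touched.
-/

noncomputable section

namespace Summit.QuantumFields.BalabanUV.Beta.FP.ConstrainedBiLaplacianSbTowerLimit

open Complex Finset Filter Topology
open Literature.MathematicalPhysics.QuantumFieldTheory.Balaban1983to89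
open Literature.MathematicalPhysics.QuantumFieldTheory.Balaban1983to89.B4Strip
open Literature.MathematicalPhysics.QuantumFieldTheory.Balaban1983to89.B4ContourShift
open Literature.MathematicalPhysics.QuantumFieldTheory.Balaban1983to89.B4Green244 (coarse offset finePt coarse_finePt)
open Summit.QuantumFields.BalabanUV.Beta.FP.ConstrainedBiLaplacianStrip
open Summit.QuantumFields.BalabanUV.Beta.FP.ConstrainedBiLaplacianKernel
open Summit.QuantumFields.BalabanUV.Beta.FP.ConstrainedBiLaplacianSubcell (avgM latticeKernel_avgM)
open Summit.QuantumFields.BalabanUV.Beta.FP.ConstrainedBiLaplacianSbFull (KS)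
open Summit.QuantumFields.BalabanUV.Beta.FP.ConstrainedBiLaplacianSbJunction (Sb_eq_re_KS sum_finePt_KS)
open Summit.QuantumFields.BalabanUV.Beta.FP.ConstrainedBiLaplacianSbCellMajorant (offset_finePt)
open Summit.QuantumFields.BalabanUV.Beta.FP.ConstrainedBiLaplacianSbTwoLevelEstimate (CD CC)
open Summit.QuantumFields.BalabanUV.Beta.FP.ConstrainedBiLaplacianSbTwoLevelRate (CR CR_nonneg two_leg_cell_kernel_rate)
open Summit.QuantumFields.BalabanUV.Beta.FP.ConstrainedBiLaplacianResponseTowerLimit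
  (towerLim abs_sub_towerLim_le tendsto_towerLim tendsto_pow_towerLim cellNat cellNat_Tsub cellIdx cellNat_eq_iff)
open Summit.QuantumFields.BalabanUV.Beta.GAN24.SubAveragingKernel (Tsub)
open Summit.QuantumFields.BalabanUV.Beta.GAN24.SubAveragingUnitTower (Tsub_bijective)
open Literature.MathematicalPhysics.QuantumFieldTheory.Balaban1983to89.Beta.BiLaplaceBlockKKT (Sb)
open scoped Real

variable {d : ℕ}

/-! ## §1 The cell fibre at level `n₀k` is the `Tsub`-image -/

/-- [folklore] The children `Tsub n₀ k τ₁ ρ` of a scale-`n₀` cell `τ₁` have cell test vector `τ₁`. -/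
theorem cellNat_Tsub_base (n₀ k : ℕ) [NeZero n₀] [NeZero k] (τ₁ : Fin (d + 1) → Fin n₀) (ρ : Fin (d + 1) → Fin k) :
    cellNat n₀ (n₀ * k) (Tsub n₀ k τ₁ ρ) = fun i => (τ₁ i : ℕ) := by
  have hn₀ : 0 < n₀ := Nat.pos_of_ne_zero (NeZero.ne n₀)
  have hk : 0 < k := Nat.pos_of_ne_zero (NeZero.ne k)
  funext i
  show (k * (τ₁ i : ℕ) + (ρ i : ℕ)) * n₀ / (n₀ * k) = (τ₁ i : ℕ)
  rw [mul_comm (k * (τ₁ i : ℕ) + (ρ i : ℕ)) n₀, Nat.mul_div_mul_left _ _ hn₀, Nat.mul_add_div hk, Nat.div_eq_of_lt (ρ i).isLt, add_zero]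

/-- [folklore] **A CELL SUM IS THE SUM OVER THE `Tsub`-IMAGE**: `Σ_{T : cellNat T = τ₀} f T = Σ_ρ f (Tsub n₀ k τ₀ ρ)`. -/
theorem sum_cell_eq (n₀ k : ℕ) [NeZero n₀] [NeZero k] (τ₀ : Fin (d + 1) → Fin n₀) (f : (Fin (d + 1) → Fin (n₀ * k)) → ℂ) :
    ∑ T : Fin (d + 1) → Fin (n₀ * k), (if cellNat n₀ (n₀ * k) T = (fun i => (τ₀ i : ℕ)) then f T else 0)
      = ∑ ρ : Fin (d + 1) → Fin k, f (Tsub n₀ k τ₀ ρ) := by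
  rw [← (Tsub_bijective (d := d + 1) n₀ k).sum_comp
    (fun T => if cellNat n₀ (n₀ * k) T = (fun i => (τ₀ i : ℕ)) then f T else 0), Fintype.sum_prod_type]
  simp only [cellNat_Tsub_base]
  have hiff : ∀ τ₁ : Fin (d + 1) → Fin n₀, ((fun i => ((τ₁ i : ℕ))) = fun i => (τ₀ i : ℕ)) ↔ τ₁ = τ₀ := fun τ₁ =>
    ⟨fun h => funext fun i => Fin.ext (congrFun h i), fun h => by rw [h]⟩
  have e : ∀ τ₁ : Fin (d + 1) → Fin n₀, ∑ ρ : Fin (d + 1) → Fin k,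
      (if ((fun i => ((τ₁ i : ℕ))) = fun i => (τ₀ i : ℕ)) then f (Tsub n₀ k τ₁ ρ) else 0)
      = if τ₁ = τ₀ then ∑ ρ : Fin (d + 1) → Fin k, f (Tsub n₀ k τ₁ ρ) else 0 := by
    intro τ₁
    by_cases h : τ₁ = τ₀
    · simp [h]
    · rw [if_neg h]; exact Finset.sum_eq_zero fun ρ _ => by rw [if_neg (fun h' => h ((hiff τ₁).mp h'))]
  rw [Finset.sum_congr rfl (fun τ₁ _ => e τ₁), Finset.sum_ite_eq' Finset.univ τ₀, if_pos (Finset.mem_univ _)]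

/-! ## §2 The two-leg cell sums of the constrained inverse and their one-step law -/

/-- [our object] **THE TWO-LEG CELL SUM** of the level-`N` offset-pair kernel over the scale-`n₀` cells `τ₀` (left leg) and `σ₀` (right leg) at block
separation `x`, normalised by the cell-pair count `(N∕n₀)^{d+1}` (total in `N`; junk `0` at `N = 0`). -/
def ScellT (n₀ : ℕ) (τ₀ σ₀ : Fin (d + 1) → Fin n₀) (x : Fin (d + 1) → ℤ) (N : ℕ) : ℂ :=
  if hN : N = 0 then 0 else
    haveI : NeZero N := ⟨hN⟩
    ((((N : ℂ) / n₀) ^ (d + 1))⁻¹ *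
      ∑ T : Fin (d + 1) → Fin N, (if cellNat n₀ N T = (fun i => (τ₀ i : ℕ)) then
        ∑ T' : Fin (d + 1) → Fin N, (if cellNat n₀ N T' = (fun i => (σ₀ i : ℕ)) then latticeKernel (M N 2 T T') x else 0) else 0))

/-- [folklore] The cell sum at a level `N ≥ 1`, unfolded. -/
theorem ScellT_def (n₀ : ℕ) (τ₀ σ₀ : Fin (d + 1) → Fin n₀) (x : Fin (d + 1) → ℤ) (N : ℕ) [NeZero N] :
    ScellT n₀ τ₀ σ₀ x N = ((((N : ℂ) / n₀) ^ (d + 1))⁻¹ *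
      ∑ T : Fin (d + 1) → Fin N, (if cellNat n₀ N T = (fun i => (τ₀ i : ℕ)) then
        ∑ T' : Fin (d + 1) → Fin N, (if cellNat n₀ N T' = (fun i => (σ₀ i : ℕ)) then latticeKernel (M N 2 T T') x else 0) else 0)) := by
  unfold ScellT; rw [dif_neg (NeZero.ne N)]

/-- [our proof] **THE CELL FIBRE IS THE `Tsub`-IMAGE**: `ScellT n₀ τ₀ σ₀ x (n₀k) = k^{−(d+1)}·Σ_{ρρ′} latticeKernel (M (n₀k) 2 (Tsub τ₀ ρ) (Tsub σ₀ ρ′)) x`. -/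
theorem ScellT_eq (n₀ k : ℕ) [NeZero n₀] [NeZero k] (τ₀ σ₀ : Fin (d + 1) → Fin n₀) (x : Fin (d + 1) → ℤ) :
    ScellT n₀ τ₀ σ₀ x (n₀ * k) = (((k : ℂ)) ^ (d + 1))⁻¹ *
      ∑ ρ : Fin (d + 1) → Fin k, ∑ ρ' : Fin (d + 1) → Fin k, latticeKernel (M (n₀ * k) 2 (Tsub n₀ k τ₀ ρ) (Tsub n₀ k σ₀ ρ')) x := by
  have hn₀ : (n₀ : ℂ) ≠ 0 := Nat.cast_ne_zero.mpr (NeZero.ne n₀)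
  rw [ScellT_def, sum_cell_eq]
  simp_rw [sum_cell_eq]
  congr 2
  push_cast
  field_simp

/-- [our proof] **ONE STEP UP THE TOWER**: `ScellT n₀ τ₀ σ₀ x (n₀kL) = k^{−(d+1)}·Σ_{ρρ′} L^{d+1}·latticeKernel (avgM (n₀k) L 2 (Tsub τ₀ ρ) (Tsub σ₀ ρ′)) x`
(children of children: `cellNat_Tsub`, then FILE 1's `latticeKernel_avgM`). -/
theorem ScellT_mul_eq (n₀ k L : ℕ) [NeZero n₀] [NeZero k] [NeZero L] (τ₀ σ₀ : Fin (d + 1) → Fin n₀) (x : Fin (d + 1) → ℤ) :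
    ScellT n₀ τ₀ σ₀ x (n₀ * k * L) = (((k : ℂ)) ^ (d + 1))⁻¹ *
      ∑ ρ : Fin (d + 1) → Fin k, ∑ ρ' : Fin (d + 1) → Fin k,
        (L : ℂ) ^ (d + 1) * latticeKernel (avgM (n₀ * k) L 2 (Tsub n₀ k τ₀ ρ) (Tsub n₀ k σ₀ ρ')) x := by
  have hn₀ : (n₀ : ℂ) ≠ 0 := Nat.cast_ne_zero.mpr (NeZero.ne n₀)
  have hL : (L : ℂ) ≠ 0 := Nat.cast_ne_zero.mpr (NeZero.ne L)
  have hLd : (L : ℂ) ^ (d + 1) ≠ 0 := pow_ne_zero _ hL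
  haveI : NeZero (n₀ * k * L) := ⟨mul_ne_zero (mul_ne_zero (NeZero.ne n₀) (NeZero.ne k)) (NeZero.ne L)⟩
  rw [ScellT_def]
  -- outer leg: children of children
  have hreL : ∀ (g : (Fin (d + 1) → Fin (n₀ * k * L)) → ℂ) (c₀ : Fin (d + 1) → Fin n₀),
      ∑ T : Fin (d + 1) → Fin (n₀ * k * L), (if cellNat n₀ (n₀ * k * L) T = (fun i => (c₀ i : ℕ)) then g T else 0)
        = ∑ ρ : Fin (d + 1) → Fin k, ∑ μ : Fin (d + 1) → Fin L, g (Tsub (n₀ * k) L (Tsub n₀ k c₀ ρ) μ) := by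
    intro g c₀
    rw [← (Tsub_bijective (d := d + 1) (n₀ * k) L).sum_comp
      (fun T => if cellNat n₀ (n₀ * k * L) T = (fun i => (c₀ i : ℕ)) then g T else 0), Fintype.sum_prod_type]
    simp only [cellNat_Tsub n₀ k L (Nat.pos_of_ne_zero (NeZero.ne L))]
    have e : ∀ τ' : Fin (d + 1) → Fin (n₀ * k), ∑ μ : Fin (d + 1) → Fin L,
        (if cellNat n₀ (n₀ * k) τ' = (fun i => (c₀ i : ℕ)) then g (Tsub (n₀ * k) L τ' μ) else 0)
        = if cellNat n₀ (n₀ * k) τ' = (fun i => (c₀ i : ℕ)) then ∑ μ : Fin (d + 1) → Fin L, g (Tsub (n₀ * k) L τ' μ) else 0 := by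
      intro τ'; split_ifs <;> simp
    rw [Finset.sum_congr rfl (fun τ' _ => e τ'), sum_cell_eq]
  rw [hreL]
  simp_rw [hreL, latticeKernel_avgM]
  rw [show (((n₀ * k * L : ℕ) : ℂ) / n₀) ^ (d + 1) = (k : ℂ) ^ (d + 1) * (L : ℂ) ^ (d + 1) by push_cast; field_simp; ring]
  rw [mul_inv, mul_assoc]
  congr 1
  rw [Finset.mul_sum]
  refine Finset.sum_congr rfl fun ρ _ => ?_
  rw [Finset.sum_comm, Finset.mul_sum]
  refine Finset.sum_congr rfl fun ρ' _ => ?_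
  field_simp

/-- [our proof] **THE ONE-STEP LAW OF THE TWO-LEG CELL SUMS** (FILE R): for every `k, L ≥ 1`,
`‖ScellT n₀ τ₀ σ₀ x (n₀kL) − ScellT n₀ τ₀ σ₀ x (n₀k)‖ ≤ CR (d+1) L n₀∕(n₀k)²·e^{−kappaB (d+1) 2·|x|_∞}`. -/
theorem ScellT_step (n₀ : ℕ) [NeZero n₀] (τ₀ σ₀ : Fin (d + 1) → Fin n₀) (x : Fin (d + 1) → ℤ) (k L : ℕ) (hk : 1 ≤ k) (hL : 1 ≤ L) :
    ‖ScellT n₀ τ₀ σ₀ x (n₀ * k * L) - ScellT n₀ τ₀ σ₀ x (n₀ * k)‖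
      ≤ CR (d + 1) L n₀ / (((n₀ * k : ℕ) : ℝ)) ^ 2 * Real.exp (-(kappaB (d + 1) 2 * supNorm x)) := by
  haveI : NeZero k := ⟨by omega⟩
  haveI : NeZero L := ⟨by omega⟩
  have hk0 : (0 : ℝ) < k := by exact_mod_cast hk
  rw [ScellT_mul_eq, ScellT_eq, ← mul_sub, ← Finset.sum_sub_distrib]
  simp_rw [← Finset.sum_sub_distrib]
  rw [norm_mul, norm_inv, norm_pow, Complex.norm_natCast]
  have h := two_leg_cell_kernel_rate n₀ k L τ₀ σ₀ x
  calc ((k : ℝ) ^ (d + 1))⁻¹ * ‖∑ ρ : Fin (d + 1) → Fin k, ∑ ρ' : Fin (d + 1) → Fin k,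
        ((L : ℂ) ^ (d + 1) * latticeKernel (avgM (n₀ * k) L 2 (Tsub n₀ k τ₀ ρ) (Tsub n₀ k σ₀ ρ')) x
          - latticeKernel (M (n₀ * k) 2 (Tsub n₀ k τ₀ ρ) (Tsub n₀ k σ₀ ρ')) x)‖
      ≤ ((k : ℝ) ^ (d + 1))⁻¹ * ((k : ℝ) ^ (d + 1) * (CR (d + 1) L n₀ / (((n₀ * k : ℕ) : ℝ)) ^ 2) * Real.exp (-(kappaB (d + 1) 2 * supNorm x))) :=
        mul_le_mul_of_nonneg_left h (by positivity)
    _ = CR (d + 1) L n₀ / (((n₀ * k : ℕ) : ℝ)) ^ 2 * Real.exp (-(kappaB (d + 1) 2 * supNorm x)) := by field_simp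

/-- [folklore] The one-step law in the `C_L∕k` shape of the abstract tower lemmas (`(n₀k)^{−2} ≤ n₀^{−2}k^{−1}`). -/
theorem ScellT_step_inv (n₀ : ℕ) [NeZero n₀] (τ₀ σ₀ : Fin (d + 1) → Fin n₀) (x : Fin (d + 1) → ℤ) (k L : ℕ) (hk : 1 ≤ k) (hL : 1 ≤ L) :
    ‖ScellT n₀ τ₀ σ₀ x (n₀ * (k * L)) - ScellT n₀ τ₀ σ₀ x (n₀ * k)‖
      ≤ (CR (d + 1) L n₀ / (n₀ : ℝ) ^ 2) / (k : ℝ) * Real.exp (-(kappaB (d + 1) 2 * supNorm x)) := by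
  have hn₀ : (0 : ℝ) < n₀ := by exact_mod_cast Nat.pos_of_ne_zero (NeZero.ne n₀)
  have hk0 : (1 : ℝ) ≤ k := by exact_mod_cast hk
  have hCR := CR_nonneg (d + 1) L n₀
  rw [← mul_assoc]
  refine (ScellT_step n₀ τ₀ σ₀ x k L hk hL).trans (mul_le_mul_of_nonneg_right ?_ (Real.exp_pos _).le)
  rw [div_div]
  refine div_le_div_of_nonneg_left hCR (by positivity) ?_
  push_cast
  rw [mul_pow]
  have hk2 : (k : ℝ) ≤ (k : ℝ) ^ 2 := by nlinarith
  exact mul_le_mul_of_nonneg_left hk2 (by positivity)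

/-! ## §3 an2's `Sb` with both legs cell-integrated: the real part, the limit, the rate, the zero block sum -/

/-- [our object] **THE TWO-LEG CELL SUM OF an2's `Sb`**: `(N∕n₀)^{−(d+1)}·N^{−4}·Σ_{T ∈ τ₀, T′ ∈ σ₀} Sb_N (finePt N X T) (finePt N Y T′)` (junk `0` at `N = 0`). -/
def SbCell (n₀ : ℕ) (τ₀ σ₀ : Fin (d + 1) → Fin n₀) (X Y : Fin (d + 1) → ℤ) (N : ℕ) : ℝ :=
  if hN : N = 0 then 0 else
    haveI : NeZero N := ⟨hN⟩
    ((((N : ℝ) / n₀) ^ (d + 1))⁻¹ * ((((N : ℝ)) ^ 4)⁻¹ *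
      ∑ T : Fin (d + 1) → Fin N, (if cellNat n₀ N T = (fun i => (τ₀ i : ℕ)) then
        ∑ T' : Fin (d + 1) → Fin N, (if cellNat n₀ N T' = (fun i => (σ₀ i : ℕ)) then Sb (N := N) (finePt N X T) (finePt N Y T') else 0) else 0)))

/-- [our proof] **JUNCTION**: `SbCell n₀ τ₀ σ₀ X Y N = Re (ScellT n₀ τ₀ σ₀ (X − Y) N)` (gen 28's `Sb_eq_re_KS` at fine points). -/
theorem SbCell_eq_re (n₀ : ℕ) (τ₀ σ₀ : Fin (d + 1) → Fin n₀) (X Y : Fin (d + 1) → ℤ) (N : ℕ) :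
    SbCell n₀ τ₀ σ₀ X Y N = (ScellT n₀ τ₀ σ₀ (X - Y) N).re := by
  by_cases hN : N = 0
  · simp [SbCell, ScellT, hN]
  · haveI : NeZero N := ⟨hN⟩
    have hN0 : (N : ℝ) ≠ 0 := by exact_mod_cast hN
    unfold SbCell
    rw [dif_neg hN, ScellT_def]
    have eS : ∀ T T' : Fin (d + 1) → Fin N, Sb (N := N) (finePt N X T) (finePt N Y T')
        = (N : ℝ) ^ 4 * (latticeKernel (M N 2 T T') (X - Y)).re := by
      intro T T'
      rw [Sb_eq_re_KS]; unfold KS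
      rw [offset_finePt, offset_finePt, coarse_finePt, coarse_finePt]
      rw [show ((N : ℂ) ^ 4) = (((N : ℝ) ^ 4 : ℝ) : ℂ) by push_cast; ring, Complex.re_ofReal_mul]
    simp_rw [eS]
    have epref : ((((N : ℂ) / n₀) ^ (d + 1))⁻¹) = (((((N : ℝ) / n₀) ^ (d + 1))⁻¹ : ℝ) : ℂ) := by push_cast; ring
    rw [epref, Complex.re_ofReal_mul, Complex.re_sum]
    congr 1
    rw [Finset.mul_sum]
    refine Finset.sum_congr rfl fun T _ => ?_
    split_ifs with hT
    · rw [Complex.re_sum, Finset.mul_sum]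
      refine Finset.sum_congr rfl fun T' _ => ?_
      split_ifs with hT'
      · field_simp
      · simp
    · simp

/-- [folklore] The one-step hypothesis of the abstract tower lemmas for `k ↦ SbCell (n₀k)`. -/
theorem SbCell_hyp (n₀ : ℕ) [NeZero n₀] (τ₀ σ₀ : Fin (d + 1) → Fin n₀) (X Y : Fin (d + 1) → ℤ) :
    ∀ k L : ℕ, 1 ≤ k → 1 ≤ L → |SbCell n₀ τ₀ σ₀ X Y (n₀ * (k * L)) - SbCell n₀ τ₀ σ₀ X Y (n₀ * k)|
      ≤ (CR (d + 1) L n₀ / (n₀ : ℝ) ^ 2) / (k : ℝ) * Real.exp (-(kappaB (d + 1) 2 * supNorm (X - Y))) := by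
  intro k L hk hL
  rw [SbCell_eq_re, SbCell_eq_re, ← Complex.sub_re]
  exact (Complex.abs_re_le_norm _).trans (ScellT_step_inv n₀ τ₀ σ₀ (X - Y) k L hk hL)

/-- [our object] THE LIMIT OF THE TWO-LEG CELL SUMS (the tower limit of `k ↦ SbCell (n₀k)`; NAMED, not identified with a continuum object). -/
def SbCellLim (n₀ : ℕ) (τ₀ σ₀ : Fin (d + 1) → Fin n₀) (X Y : Fin (d + 1) → ℤ) : ℝ := towerLim fun k => SbCell n₀ τ₀ σ₀ X Y (n₀ * k)

/-- [our proof] **THE TWO-LEG CELL-INTEGRATED `Sb` CONVERGES WITH RATE `1∕k`**: for every scale `n₀ ≥ 1`, cells `τ₀, σ₀`, blocks `X, Y`, every `k ≥ 1`,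
`|SbCell (n₀k) − SbCellLim| ≤ 2·((CR (d+1) 2 n₀∕n₀²)∕k·e^{−kappaB (d+1) 2·|X − Y|_∞})`. -/
theorem abs_SbCell_sub_SbCellLim_le (n₀ : ℕ) [NeZero n₀] (τ₀ σ₀ : Fin (d + 1) → Fin n₀) (X Y : Fin (d + 1) → ℤ) (k : ℕ) (hk : 1 ≤ k) :
    |SbCell n₀ τ₀ σ₀ X Y (n₀ * k) - SbCellLim n₀ τ₀ σ₀ X Y|
      ≤ 2 * ((CR (d + 1) 2 n₀ / (n₀ : ℝ) ^ 2) / (k : ℝ) * Real.exp (-(kappaB (d + 1) 2 * supNorm (X - Y)))) :=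
  abs_sub_towerLim_le (F := fun k => SbCell n₀ τ₀ σ₀ X Y (n₀ * k)) (C := fun L => CR (d + 1) L n₀ / (n₀ : ℝ) ^ 2) (SbCell_hyp n₀ τ₀ σ₀ X Y) hk

/-- [our proof] **CONVERGENCE THROUGH ALL REFINEMENTS**: `SbCell (n₀k) → SbCellLim` as `k → ∞`. -/
theorem tendsto_SbCell (n₀ : ℕ) [NeZero n₀] (τ₀ σ₀ : Fin (d + 1) → Fin n₀) (X Y : Fin (d + 1) → ℤ) :
    Tendsto (fun k : ℕ => SbCell n₀ τ₀ σ₀ X Y (n₀ * k)) atTop (𝓝 (SbCellLim n₀ τ₀ σ₀ X Y)) :=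
  tendsto_towerLim (F := fun k => SbCell n₀ τ₀ σ₀ X Y (n₀ * k)) (C := fun L => CR (d + 1) L n₀ / (n₀ : ℝ) ^ 2) (SbCell_hyp n₀ τ₀ σ₀ X Y)

/-- [our proof] **REFINEMENT INDEPENDENCE**: along every refinement tower `N = n₀L^j`, `L ≥ 2`, the two-leg cell sums tend to the same `SbCellLim`. -/
theorem tendsto_SbCell_pow (n₀ : ℕ) [NeZero n₀] (τ₀ σ₀ : Fin (d + 1) → Fin n₀) (X Y : Fin (d + 1) → ℤ) {L : ℕ} (hL : 2 ≤ L) :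
    Tendsto (fun j : ℕ => SbCell n₀ τ₀ σ₀ X Y (n₀ * L ^ j)) atTop (𝓝 (SbCellLim n₀ τ₀ σ₀ X Y)) :=
  tendsto_pow_towerLim (F := fun k => SbCell n₀ τ₀ σ₀ X Y (n₀ * k)) (C := fun L => CR (d + 1) L n₀ / (n₀ : ℝ) ^ 2) (SbCell_hyp n₀ τ₀ σ₀ X Y) hL

/-- [folklore] **ZERO BLOCK SUM AT EVERY LEVEL**: `Σ_{τ₀} SbCell n₀ τ₀ σ₀ X Y (n₀k) = 0` (the left leg summed over the whole block: gen 28's `sum_finePt_KS`). -/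
theorem sum_SbCell (n₀ : ℕ) [NeZero n₀] (σ₀ : Fin (d + 1) → Fin n₀) (X Y : Fin (d + 1) → ℤ) (k : ℕ) (hk : 1 ≤ k) :
    ∑ τ₀ : Fin (d + 1) → Fin n₀, SbCell n₀ τ₀ σ₀ X Y (n₀ * k) = 0 := by
  haveI : NeZero k := ⟨by omega⟩
  simp_rw [SbCell_eq_re]
  rw [← Complex.re_sum]
  simp_rw [ScellT_def]
  rw [← Finset.mul_sum, Finset.sum_comm]
  have h1 : ∀ T : Fin (d + 1) → Fin (n₀ * k), ∑ τ₀ : Fin (d + 1) → Fin n₀,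
      (if cellNat n₀ (n₀ * k) T = (fun i => (τ₀ i : ℕ)) then
        ∑ T' : Fin (d + 1) → Fin (n₀ * k), (if cellNat n₀ (n₀ * k) T' = (fun i => (σ₀ i : ℕ)) then latticeKernel (M (n₀ * k) 2 T T') (X - Y) else 0)
        else 0)
      = ∑ T' : Fin (d + 1) → Fin (n₀ * k), (if cellNat n₀ (n₀ * k) T' = (fun i => (σ₀ i : ℕ)) then latticeKernel (M (n₀ * k) 2 T T') (X - Y) else 0) := by
    intro T
    simp_rw [cellNat_eq_iff]
    rw [Finset.sum_ite_eq' Finset.univ (cellIdx n₀ k T), if_pos (Finset.mem_univ _)]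
  simp_rw [h1]
  rw [Finset.sum_comm]
  have h2 : ∀ T' : Fin (d + 1) → Fin (n₀ * k), ∑ T : Fin (d + 1) → Fin (n₀ * k),
      (if cellNat n₀ (n₀ * k) T' = (fun i => (σ₀ i : ℕ)) then latticeKernel (M (n₀ * k) 2 T T') (X - Y) else 0) = 0 := by
    intro T'
    split_ifs
    · have h := sum_finePt_KS (N := n₀ * k) 2 X (finePt (n₀ * k) Y T')
      unfold KS at h
      simp_rw [offset_finePt, coarse_finePt] at h
      exact h
    · simp
  simp_rw [h2]
  simp

/-- [our proof] **ZERO BLOCK SUM IN THE LIMIT**: `Σ_{τ₀} SbCellLim n₀ τ₀ σ₀ X Y = 0` for every scale `n₀ ≥ 1`. -/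
theorem sum_SbCellLim (n₀ : ℕ) [NeZero n₀] (σ₀ : Fin (d + 1) → Fin n₀) (X Y : Fin (d + 1) → ℤ) :
    ∑ τ₀ : Fin (d + 1) → Fin n₀, SbCellLim n₀ τ₀ σ₀ X Y = 0 := by
  have h : Tendsto (fun k : ℕ => ∑ τ₀ : Fin (d + 1) → Fin n₀, SbCell n₀ τ₀ σ₀ X Y (n₀ * k)) atTop
      (𝓝 (∑ τ₀ : Fin (d + 1) → Fin n₀, SbCellLim n₀ τ₀ σ₀ X Y)) :=
    tendsto_finsetSum _ fun τ₀ _ => tendsto_SbCell n₀ τ₀ σ₀ X Y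
  have h' : Tendsto (fun k : ℕ => ∑ τ₀ : Fin (d + 1) → Fin n₀, SbCell n₀ τ₀ σ₀ X Y (n₀ * k)) atTop (𝓝 0) := by
    refine (tendsto_const_nhds (x := (0 : ℝ))).congr' ?_
    filter_upwards [eventually_ge_atTop 1] with k hk
    exact (sum_SbCell n₀ σ₀ X Y k hk).symm
  exact tendsto_nhds_unique h h'

end Summit.QuantumFields.BalabanUV.Beta.FP.ConstrainedBiLaplacianSbTowerLimit

end
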